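import Literature.NumberTheory.Automorphic.Liu2021.Def411WeilCarriersLocalTypesOfEquiv
import HarnessLib

/-!
# The RESTRICTION STEP of «Statement (2) follows from Lemma D.1» ([Liu2021] l. 2270) at EVERY rank `n ≥ 1` — rank-free twin of
# ★ `Def411WeilCarriers.nonempty_equiv_localTypes_of_equivId_of_isIrreducible` (which carries a cosmetic `3 ≤ n` used only for `NeZero n`)

Cell `hodgecm-mathlib`, half A line LD2 (socket 27458 `stub_S1b_facts`; organ U₂′ `TwoTriples₂` of LD2-plan's skeleton, its same-λ half «line-class
rigidity» = ★ `F0LD2LineClassOfEquiv.lineClassRigidity₂_of_equivForces`'s hypothesis E₂) and line LD1 (organ (P♯) «line pin»), seat LD2-p01 (g0),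
2026-09-02.  THEOREMS ONLY (one theorem; no definition, no `sorry`, no instance, no notation); `--supports stmt-HodgeConjecture-24832`.

WHAT.  ★ `nonempty_equiv_localTypes_of_equivId_of_isIrreducible` (`Liu2021/Def411WeilCarriersLocalTypesOfEquiv.lean` §3): an equivalence
`rhoAtLine … hs id a χ ≃ rhoAtLine … hs' id a' χ'` of a NON-ZERO carrier restricts, at every finite place `v`, to an equivalence of the LOCAL TYPES
`X_v(𝓢, a, χ) ≃ X_v(𝓢', a', χ')` of `U(J_V)(F_v)`, the types being irreducible (instances) — [FlathCorvallis1979, Thm. 3] uniqueness clause via ★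
`nonempty_equiv_of_isotypicComponent_eq_top` + ★ `isotypicComponent_rhoAtLine_comp_eq_top_of_factors` + ★ `survival_atLine`.  Its displayed rank
hypothesis `hn : 3 ≤ n` is used ONLY to produce `NeZero n` for ★ `survival_atLine`; this file states the SAME theorem with `hn : 1 ≤ n` and the
SAME proof, so that the rank-2 θ-packages of [Liu2021, App. D] (the unitary Shimura CURVES: `N = n = 2`) can use it.  Nothing of print is
asserted; the irreducibility of the local types is an INPUT (at rank 2: ★ `isIrreducibleOrZero_and_isAdmissible_local (2 ≤ n)` + non-vanishing).

HONEST LABEL.  HC_CM is proved only modulo the 7 printed citations (2 remaining: hLiu418 = stmt-HodgeConjecture-24832, h413 =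
stmt-HodgeConjecture-24833) until rung 0 closes; this file discharges none of them.

## References
* [Liu2021] Y. Liu, Camb. J. Math. 9 (2021) = arXiv:2102.11518: Def. 4.11 (l. 2092–2096), Thm. 4.18 (2) and its proof (l. 2270), App. D Lem. D.1.
* [FlathCorvallis1979] D. Flath, PSPM 33.1 (1979), Theorem 3 (uniqueness clause).  [Bump1997] D. Bump, CUP 1997, §3.4 Prop. 3.4.1.
-/

set_option autoImplicit false
set_option linter.dupNamespace false

noncomputable section

open scoped Matrix Kronecker RestrictedProduct NumberField Classical
open NumberField IsDedekindDomain Filter Set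
open Literature.NumberTheory Literature.NumberTheory.Automorphic Literature.NumberTheory.Automorphic.UnitaryGroup
open Literature.NumberTheory.GelbartRogawski1991 Literature.NumberTheory.GelbartRogawski1991.UnitaryDualPair
open Literature.NumberTheory.GelbartRogawski1991.UnitaryDualPair.WeilCoinv
open Literature.NumberTheory.Weil1964 Literature.RepresentationTheory
open Literature.NumberTheory.Automorphic.Liu2021 Literature.NumberTheory.Automorphic.Liu2021.Def411WeilCarriers

namespace Summit.HodgeConjecture.HodgeConjecture.Cruxes.HLiu418.F0LD2LocalTypesOfEquivAnyRank

variable (F E : Type) [Field F] [NumberField F] [Field E] [NumberField E] [Algebra F E]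
variable (c : E ≃ₐ[F] E) (N : ℕ) {n : ℕ} (e : Fin N × Fin 1 ≃ Fin n)
variable (JV : Matrix (Fin N) (Fin N) E) {TV : Matrix (Fin N) (Fin N) F}
variable [Algebra.IsQuadraticExtension F E] {δ : E} (hcδ : c δ = -δ) (hδ : δ ≠ 0) {d : F} (hd : δ * δ = algebraMap F E d)

/-- **THE RESTRICTION STEP at every rank `n ≥ 1`** (★ `nonempty_equiv_localTypes_of_equivId_of_isIrreducible` with its cosmetic `3 ≤ n`
replaced by `1 ≤ n`; same proof): an equivalence `rhoAtLine … hs id a χ ≃ rhoAtLine … hs' id a' χ'` of a NON-ZERO carrier restricts, at every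
finite place `v`, to an equivalence of the (irreducible) local types `X_v(𝓢, a, χ) ≃ X_v(𝓢', a', χ')` of `U(J_V)(F_v)`.
[cite: Liu2021, Def. 4.11 (l. 2092–2096), Thm. 4.18 (2) with proof l. 2270; FlathCorvallis1979, Theorem 3 (uniqueness clause); Bump1997, §3.4 Prop. 3.4.1] -/
theorem nonempty_equiv_localTypes_of_equivId_of_isIrreducible_of_one_le (hV : TV.IsSymm) (hVd : IsUnit TV.det)
    (hJV : JV = TV.map (algebraMap F E))
    {s : ∀ a : Fˣ, UnitaryGroup.adelicPair F E c N 1 JV (JW F E a) →* adelicMpCont F (Fin n) (adelicGram F e TV (TW F a))}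
    (hs : ∀ a : Fˣ, (splittingDatum F E c N 1 e JV (JW F E a) hcδ hδ hd hV (isSymm_TW F a) hVd (isUnit_det_TW F a) hJV
      (JW_eq F E a)).IsCompatible (s a))
    {s' : ∀ a : Fˣ, UnitaryGroup.adelicPair F E c N 1 JV (JW F E a) →* adelicMpCont F (Fin n) (adelicGram F e TV (TW F a))}
    (hs' : ∀ a : Fˣ, (splittingDatum F E c N 1 e JV (JW F E a) hcδ hδ hd hV (isSymm_TW F a) hVd (isUnit_det_TW F a) hJV
      (JW_eq F E a)).IsCompatible (s' a))
    (a : Fˣ) (χ : Chi F E c)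
    (𝓢 : LocalSplitting.FinLocalSplittings F E c n hcδ hδ hd (gram F e TV (TW F a)) (isSymm_gram F e hV (isSymm_TW F a))
      (reindex_kronecker_eq_gram_map F E e hJV (JW_eq F E a)))
    (a' : Fˣ) (χ' : Chi F E c)
    (𝓢' : LocalSplitting.FinLocalSplittings F E c n hcδ hδ hd (gram F e TV (TW F a')) (isSymm_gram F e hV (isSymm_TW F a'))
      (reindex_kronecker_eq_gram_map F E e hJV (JW_eq F E a')))
    (hfac : (pairSmall₁ F E c N 1 e JV (JW F E a) (s a)).comp (finPairToAdelic F E c N 1 JV (JW F E a)) =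
      localRefSection F E c N 1 e JV (JW F E a) hcδ hδ hd hV (isSymm_TW F a) hJV (JW_eq F E a) 𝓢)
    (hfac' : (pairSmall₁ F E c N 1 e JV (JW F E a') (s' a')).comp (finPairToAdelic F E c N 1 JV (JW F E a')) =
      localRefSection F E c N 1 e JV (JW F E a') hcδ hδ hd hV (isSymm_TW F a') hJV (JW_eq F E a') 𝓢')
    (hn : 1 ≤ n)
    [Nontrivial (omegaAtLine F E c N e JV hcδ hδ hd hV hVd hJV hs a χ)]
    (Eq : (rhoAtLine F E c N e JV hcδ hδ hd hV hVd hJV hs (MonoidHom.id _) a χ).Equiv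
      (rhoAtLine F E c N e JV hcδ hδ hd hV hVd hJV hs' (MonoidHom.id _) a' χ'))
    (v : HeightOneSpectrum (𝓞 F))
    [hX : (show Representation ℂ (UnitaryGroup.localPi E c N JV v) _ from
        (TwistedCoinv.rep (localCharOfCenter F E c (JW F E a) (JW_apply_ne_zero F E a) χ.1 v) (𝓢.omegaLoc v)
          (commute_omegaLoc_localCenter F E c N e JV (JW F E a) hcδ hδ hd hV (isSymm_TW F a) hJV (JW_eq F E a)
            (JW_apply_ne_zero F E a) 𝓢 v)).comp (UnitaryGroup.localLineInl E c N e JV (JW F E a) v)).IsIrreducible]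
    [hX' : (show Representation ℂ (UnitaryGroup.localPi E c N JV v) _ from
        (TwistedCoinv.rep (localCharOfCenter F E c (JW F E a') (JW_apply_ne_zero F E a') χ'.1 v) (𝓢'.omegaLoc v)
          (commute_omegaLoc_localCenter F E c N e JV (JW F E a') hcδ hδ hd hV (isSymm_TW F a') hJV (JW_eq F E a')
            (JW_apply_ne_zero F E a') 𝓢' v)).comp (UnitaryGroup.localLineInl E c N e JV (JW F E a') v)).IsIrreducible] :
    Nonempty ((show Representation ℂ (UnitaryGroup.localPi E c N JV v) _ from
        (TwistedCoinv.rep (localCharOfCenter F E c (JW F E a) (JW_apply_ne_zero F E a) χ.1 v) (𝓢.omegaLoc v)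
          (commute_omegaLoc_localCenter F E c N e JV (JW F E a) hcδ hδ hd hV (isSymm_TW F a) hJV (JW_eq F E a)
            (JW_apply_ne_zero F E a) 𝓢 v)).comp (UnitaryGroup.localLineInl E c N e JV (JW F E a) v)).Equiv
      (show Representation ℂ (UnitaryGroup.localPi E c N JV v) _ from
        (TwistedCoinv.rep (localCharOfCenter F E c (JW F E a') (JW_apply_ne_zero F E a') χ'.1 v) (𝓢'.omegaLoc v)
          (commute_omegaLoc_localCenter F E c N e JV (JW F E a') hcδ hδ hd hV (isSymm_TW F a') hJV (JW_eq F E a')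
            (JW_apply_ne_zero F E a') 𝓢' v)).comp (UnitaryGroup.localLineInl E c N e JV (JW F E a') v))) := by
  haveI : NeZero n := ⟨by omega⟩
  exact Literature.RepresentationTheory.Liu2021.nonempty_equiv_of_isotypicComponent_eq_top
    (UnitaryGroup.inclPlace F E c N JV v) Eq
    (isotypicComponent_rhoAtLine_comp_eq_top_of_factors F E c N e JV hcδ hδ hd hV hVd hJV hs a χ 𝓢
      (fun w => UnitaryGroup.localLineInl E c N e JV (JW F E a) w)
      (UnitaryGroup.eventually_localLineInl_mapsTo_localInt E c N e JV (JW F E a)) (MonoidHom.id _) hfac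
      (survival_atLine F E c N e JV hcδ hδ hd hV hVd hJV a χ 𝓢) v (UnitaryGroup.inclPlace F E c N JV v) fun g =>
        UnitaryGroup.finAdelicEquiv_finPairEmb_inclPlace E c N e JV (JW F E a) v g)
    (isotypicComponent_rhoAtLine_comp_eq_top_of_factors F E c N e JV hcδ hδ hd hV hVd hJV hs' a' χ' 𝓢'
      (fun w => UnitaryGroup.localLineInl E c N e JV (JW F E a') w)
      (UnitaryGroup.eventually_localLineInl_mapsTo_localInt E c N e JV (JW F E a')) (MonoidHom.id _) hfac'
      (survival_atLine F E c N e JV hcδ hδ hd hV hVd hJV a' χ' 𝓢') v (UnitaryGroup.inclPlace F E c N JV v) fun g =>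
        UnitaryGroup.finAdelicEquiv_finPairEmb_inclPlace E c N e JV (JW F E a') v g)

end Summit.HodgeConjecture.HodgeConjecture.Cruxes.HLiu418.F0LD2LocalTypesOfEquivAnyRank

end
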